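import Summits.ResolutionOfSingularities.ResolutionOfSingularities.Theorems.UniversalCellsPrimeFieldToPerfectStubClimbAlgebraic
import Mathlib.FieldTheory.RatFunc.AsPolynomial
import Mathlib.FieldTheory.PurelyInseparable.PerfectClosure
import Mathlib.FieldTheory.AlgebraicClosure
import Mathlib.FieldTheory.IsAlgClosed.Basic
import Mathlib.FieldTheory.Finite.Basic
import Mathlib.Algebra.Algebra.ZMod
import HarnessLib

/-!
# Crux `PrimeModelTransfer` (stmt-ResolutionOfSingularities-8933): the tower of ALGEBRAICALLY CLOSED
# subfields — door 2 of slot W8.2 needs the shared kernel only at algebraically closed constant fields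

Route `ResolutionOfSingularities/UniformComplexity`, crux `PrimeModelTransfer` (for a prime `p`:
resolution of integral separated finite-type schemes over the algebraically closed fields ALGEBRAIC
over `𝔽_p` ⇒ the same over EVERY algebraically closed field of characteristic `p`). The registered
line `Cruxes/PrimeModelTransfer/Lines/shared_climb_kernel.lean` and the landed glue
`Theorems.PrimeModelTransfer.primeModelTransfer_of_climbRatFuncPerf` (p461439) derive the crux from
the shared open kernel `stub_climbRatFuncPerf` ("`M` PERFECT of characteristic `p` with resolution
⇒ resolution over every perfect `L` purely inseparable over `RatFunc M`"), climbing through the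
perfect closures `perfectClosure k₀(s) K`, which are NOT algebraically closed.

**This file (helpers, Theses-free).** The climb can instead be routed through the relative
ALGEBRAIC closures `A(S) := (k₀(S))^{alg} ∩ K` of the finitely generated subfields of the
algebraically closed target `K`; every field met on the way is algebraically closed, so the crux
needs the kernel ONLY for algebraically closed `M` (of finite transcendence degree over `𝔽_p`).
The strategist's census (`Cruxes/PrimeModelTransfer/STRATEGY-CENSUS.md`, §Transfer, "informative
converse, not used") recorded this restriction informally; here it is made a kernel-checked
reduction. Contents:

* `hasResolution_of_integralResOver_ringEquiv` — transport of "resolution of all integral separated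
  finite-type schemes over `Spec R`" along a ring isomorphism;
* `pow_prime_pow_eq_self_of_isAlgebraic` — an element algebraic over `ZMod p` satisfies
  `x ^ p ^ n = x` for some `n ≥ 1` (the crux's algebraicity clause, for subfields of `K`);
* `hasResolution_of_perfectSubfields` — DESCENT: over a perfect `E`, if every finite `s ⊆ E` lies
  in a perfect subfield `L ⊆ E` over which integral separated finite-type schemes are resolvable,
  then they are resolvable over `E` (the landed `stub_descentToPerfectExtensions` p460660 /
  `stub_separableDescent` p149298 / `stub_climbAlgebraic` p154863 are the instances
  `L = perfectClosure k₀(s) E`, `L = K^{perf}`-levels, `L = M(s)`);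
* `hasResolution_algebraicClosure_adjoin_simple` — ONE CLIMB between algebraically closed fields:
  `M` perfect of characteristic `p` with resolution, the kernel AT `M` (resolution over every
  perfect purely inseparable `RatFunc M`-algebra), `K ⊇ M` algebraically closed, `t ∈ K` ⇒
  resolution over the algebraic closure of `M(t)` in `K` (transcendental `t`: kernel on
  `perfectClosure M(t) ⊆ (M(t))^{alg}`, `M(t) ≅ RatFunc M`, then the landed algebraic climb;
  algebraic `t`: the algebraic climb alone);
* `exists_isAlgClosed_subfield_hasResolution` — THE TOWER: for `K` algebraically closed of
  characteristic `p`, the crux hypothesis (resolution over algebraically closed fields algebraic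
  over `𝔽_p`) and the kernel restricted to ALGEBRAICALLY CLOSED `M` of characteristic `p` give, for
  every finite `S ⊆ K`, an algebraically closed subfield `A ⊇ S` of `K` with resolution of all
  integral separated finite-type `A`-schemes (induction on `S`; base `A(∅) = 𝔽_p^{alg} ∩ K`).

The leaf file `Theorems/UniformComplexityPrimeModelTransferOfClimbAlgClosed.lean` combines the
tower with the descent into `PrimeModelTransfer` BY NAME.

[OURS · LADDER-RESOLUTION L1, slot W8.2 (prime-field / universality transfer), door 2
UniformComplexity] Helper lemmas over the summit's own route; they are NOT statements of, and
attribute nothing to, Hironaka's 2017 manuscript. Barrier bookkeeping: no lemma base-changes a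
resolution along an inseparable field extension — the descent base-changes only SMOOTH models of
schemes over PERFECT subfields (`InseparableBaseChangeResolution.not_isRegular_stable_groundFieldExtension`
and `RegularNotGeometricallyRegular` are about regular-not-smooth models over IMPERFECT fields), and
the climb re-resolves at each level through the kernel hypothesis.

Sources: Q. Liu, *Algebraic Geometry and Arithmetic Curves* (2002), Prop. 3.2.7, Cor. 4.3.33;
EGA IV₃ Thm. 8.8.2 (ii); Stacks Project 09GI (relative algebraic closure), 00TV, 056S.
[cite: Liu2002, Prop. 3.2.7 and Cor. 4.3.33]
-/

noncomputable section

set_option linter.dupNamespace false -- mandated namespace of this single-conjunct summit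

open CategoryTheory CategoryTheory.Limits AlgebraicGeometry TopologicalSpace
open Literature.AlgebraicGeometry.Resolution

namespace Summit.ResolutionOfSingularities.ResolutionOfSingularities.Theorems.PrimeModelTransfer

/-! ## §1 Two elementary transports -/

/-- **Resolution over `Spec S` from resolution over an isomorphic `Spec R`.** If every integral
separated scheme of finite type over `Spec R` has a resolution and `e : R ≃+* S`, then every
integral separated scheme of finite type over `Spec S` has one (compose the structure map with the
isomorphism `Spec S ≅ Spec R`). [folklore] -/
theorem hasResolution_of_integralResOver_ringEquiv {R S : Type} [CommRing R] [CommRing S]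
    (e : R ≃+* S)
    (h : ∀ (X : Scheme.{0}) (f : X ⟶ Spec (.of R)), IsSeparated f → LocallyOfFiniteType f →
      QuasiCompact f → IsIntegral X → Scheme.HasResolution X)
    (X : Scheme.{0}) (f : X ⟶ Spec (.of S)) (hs : IsSeparated f) (hl : LocallyOfFiniteType f)
    (hq : QuasiCompact f) (hX : IsIntegral X) : Scheme.HasResolution X := by
  let ι : Spec (.of S) ⟶ Spec (.of R) := Spec.map (CommRingCat.ofHom e.toRingHom)
  haveI : IsIso ι := inferInstanceAs (IsIso (Spec.map e.toCommRingCatIso.hom))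
  haveI := hs; haveI := hl; haveI := hq
  exact h X (f ≫ ι) inferInstance inferInstance inferInstance hX

/-- **The crux's algebraicity clause for algebraic elements.** In a field `F` of characteristic
`p`, every element algebraic over the prime field `ZMod p` satisfies `x ^ p ^ n = x` for some
`n ≥ 1`: the field `𝔽_p(x)` is finite of cardinality `p ^ n`. [folklore] -/
theorem pow_prime_pow_eq_self_of_isAlgebraic (p : ℕ) [Fact p.Prime] {F : Type} [Field F]
    [Algebra (ZMod p) F] (x : F) (hx : IsAlgebraic (ZMod p) x) :
    ∃ n : ℕ, 0 < n ∧ x ^ p ^ n = x := by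
  classical
  let E : IntermediateField (ZMod p) F := IntermediateField.adjoin (ZMod p) ({x} : Set F)
  haveI : CharP E p := charP_of_injective_algebraMap (algebraMap (ZMod p) E).injective p
  haveI : FiniteDimensional (ZMod p) E := IntermediateField.adjoin.finiteDimensional hx.isIntegral
  haveI : Finite E := Module.finite_of_finite (ZMod p)
  letI : Fintype E := Fintype.ofFinite E
  obtain ⟨n, -, hn⟩ := FiniteField.card E p
  refine ⟨n, n.pos, ?_⟩
  have hmem : x ∈ E := IntermediateField.mem_adjoin_simple_self (ZMod p) x
  have key : (⟨x, hmem⟩ : E) ^ p ^ (n : ℕ) = ⟨x, hmem⟩ := by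
    rw [← hn]
    exact FiniteField.pow_card _
  have := congrArg (fun y : E => (y : F)) key
  simpa using this

/-! ## §2 Descent: perfect subfields carrying resolution suffice -/

/-- **Descent to perfect subfields.** Let `E` be a perfect field such that every finite subset
`s ⊆ E` is contained in a PERFECT subfield `L ⊆ E` over which every integral separated scheme of
finite type has a resolution. Then every integral separated scheme of finite type over `E` has a
resolution. Proof (the landed `stub_descentToPerfectExtensions` p460660 with the perfect closure
replaced by an arbitrary perfect `L ∋ s`): spread `X` out to `X₀ / K₀`, `K₀ = closure s`
(`Theorems.stub_fgModel`); `K₀ ≤ L`; `X₀ ×_{K₀} L` is integral (dominated by `X`), resolve it over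
`L`; the resolution is regular of finite type over the perfect `L`, hence smooth, so its base
change to `E` is regular and resolves `X` (`Theorems.stub_resolutionOfRobustModel`).
[cite: Liu2002, Prop. 3.2.7 and Cor. 4.3.33] -/
theorem hasResolution_of_perfectSubfields (E : Type) [Field E] [PerfectField E]
    (h : ∀ s : Finset E, ∃ L : Subfield E, (↑s : Set E) ⊆ L ∧ PerfectField L ∧
      ∀ (X : Scheme.{0}) (f : X ⟶ Spec (.of L)), IsSeparated f → LocallyOfFiniteType f →
        QuasiCompact f → IsIntegral X → Scheme.HasResolution X)
    (X : Scheme.{0}) (f : X ⟶ Spec (.of E)) (hs : IsSeparated f) (hl : LocallyOfFiniteType f)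
    (hq : QuasiCompact f) (hX : IsIntegral X) : Scheme.HasResolution X := by
  -- adapted from Theorems/UniformComplexityPrimeModelTransferStubDescentToPerfectExtensions.lean
  classical
  -- ### Step 1: spread `X` out to a model `X₀` over a finitely generated subfield `K₀ ⊆ E`
  obtain ⟨K₀, s, hK₀, X₀, f₀, hsep, hlft, hqc, -, ⟨e⟩⟩ :=
    Summit.ResolutionOfSingularities.ResolutionOfSingularities.Theorems.stub_fgModel E X f hs hl hq
      inferInstance
  -- ### Step 2: a perfect subfield `L ⊇ s` with resolution; it contains `K₀ = closure s`
  obtain ⟨L, hsL, hLperf, hLres⟩ := h s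
  have hL : K₀ ≤ L := by
    rw [hK₀]
    exact Subfield.closure_le.2 hsL
  haveI : PerfectField L := hLperf
  -- ### Step 3: `X_L := X₀ ×_{K₀} Spec L` is integral, as `X ≅ X_L ×_L Spec E → X_L` is flat
  -- and surjective
  let iL : Spec (.of L) ⟶ Spec (.of K₀) := Spec.map (CommRingCat.ofHom (Subfield.inclusion hL))
  let jL : Spec (.of E) ⟶ Spec (.of L) := Spec.map (CommRingCat.ofHom L.subtype)
  let XL : Scheme.{0} := pullback f₀ iL
  let gL : XL ⟶ Spec (.of L) := pullback.snd f₀ iL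
  have hK : L.subtype.comp (Subfield.inclusion hL) = K₀.subtype := RingHom.ext fun _ => rfl
  have e' : jL ≫ iL = Spec.map (CommRingCat.ofHom K₀.subtype) := by
    rw [← Spec.map_comp, ← CommRingCat.ofHom_comp, hK]
  let eK : pullback gL jL ≅ pullback f₀ (Spec.map (CommRingCat.ofHom K₀.subtype)) :=
    pullbackLeftPullbackSndIso f₀ iL jL ≪≫ pullback.congrHom rfl e'
  haveI : Flat jL := by
    rw [Flat.SpecMap_iff, CommRingCat.hom_ofHom]
    exact RingHom.flat_algebraMap_iff.mpr (inferInstance : Module.Flat L E)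
  haveI : Surjective jL := by
    haveI : Subsingleton ↥(Spec (CommRingCat.of L)) :=
      inferInstanceAs (Subsingleton (PrimeSpectrum L))
    haveI : Nonempty ↥(Spec (CommRingCat.of E)) := inferInstanceAs (Nonempty (PrimeSpectrum E))
    infer_instance
  let c : X ⟶ XL := e.hom ≫ eK.inv ≫ pullback.fst gL jL
  haveI : Flat c := inferInstance
  haveI : Surjective c := inferInstance
  haveI : IsIntegral XL := by
    haveI : IsReduced XL :=
      Literature.AlgebraicGeometry.Morphisms.isReduced_of_flat_of_surjective c
    haveI : IrreducibleSpace XL := c.surjective.irreducibleSpace c.continuous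
    exact isIntegral_of_irreducibleSpace_of_isReduced XL
  -- ### Step 4: resolve `X_L` over `L`
  haveI : IsSeparated gL := inferInstance
  haveI : LocallyOfFiniteType gL := inferInstance
  haveI : QuasiCompact gL := inferInstance
  obtain ⟨Y, π, hres⟩ := hLres XL gL inferInstance inferInstance inferInstance inferInstance
  -- ### Step 5: `Y → Spec L` is smooth (regular over a perfect field), so `Y ×_L E` is regular
  haveI := hres.isProper
  haveI : Smooth (π ≫ gL) := smooth_of_isRegular_of_perfectField (π ≫ gL) hres.isRegular
  have hreg : Scheme.IsRegular (pullback (π ≫ gL) jL) := fun y =>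
    isRegularLocalRing_stalk_of_smooth_of_field (pullback.snd (π ≫ gL) jL) y
  -- ### Step 6: base change the resolution to `E` and transport along `X ≅ X₀ ×_{K₀} Spec E`
  have H :=
    Summit.ResolutionOfSingularities.ResolutionOfSingularities.Theorems.stub_resolutionOfRobustModel
      E K₀ L hL X₀ f₀ hsep hlft hqc Y π hres.isProper hres.isBirational hreg
  exact H.of_iso e.inv

/-! ## §3 One climb between algebraically closed fields -/

/-- **The climb to the algebraic closure of `M(t)` inside an algebraically closed `K`.** Let `M`
be a perfect field of characteristic `p` over which integral separated schemes of finite type are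
resolvable, and assume the transfer kernel AT `M`: resolution over every perfect field purely
inseparable over `RatFunc M`. Let `K ⊇ M` be algebraically closed and `t ∈ K`. Then integral
separated schemes of finite type over the relative algebraic closure `L` of `M(t)` in `K` are
resolvable. Proof: if `t` is transcendental over `M`, then `M(t) ≅ RatFunc M`
(`RatFunc.algEquivOfTranscendental`), the kernel resolves over the perfect purely inseparable
`L₀ := perfectClosure M(t) L` (perfect because `L` is algebraically closed), and `L / L₀` is
algebraic, so the landed algebraic climb `PrimeFieldToPerfect.stub_climbAlgebraic` (p154863)
finishes; if `t` is algebraic over `M`, then `L / M` is algebraic and the algebraic climb applies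
directly. [folklore] -/
theorem hasResolution_algebraicClosure_adjoin_simple (p : ℕ) [Fact p.Prime]
    (M : Type) [Field M] [CharP M p] [PerfectField M]
    (hM : ∀ (X : Scheme.{0}) (f : X ⟶ Spec (.of M)), IsSeparated f → LocallyOfFiniteType f →
      QuasiCompact f → IsIntegral X → Scheme.HasResolution X)
    (hRM : ∀ (L : Type) [Field L] [PerfectField L] [Algebra (RatFunc M) L]
      [IsPurelyInseparable (RatFunc M) L]
      (X : Scheme.{0}) (f : X ⟶ Spec (.of L)), IsSeparated f → LocallyOfFiniteType f →
        QuasiCompact f → IsIntegral X → Scheme.HasResolution X)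
    (K : Type) [Field K] [IsAlgClosed K] [Algebra M K] (t : K)
    (X : Scheme.{0})
    (f : X ⟶ Spec (.of (algebraicClosure (IntermediateField.adjoin M ({t} : Set K)) K)))
    (hs : IsSeparated f) (hl : LocallyOfFiniteType f) (hq : QuasiCompact f) (hX : IsIntegral X) :
    Scheme.HasResolution X := by
  -- `E = M⟮t⟯ ⊆ K` and its relative algebraic closure `L` in `K`: algebraically closed, perfect
  let E : IntermediateField M K := IntermediateField.adjoin M ({t} : Set K)
  let L : IntermediateField E K := algebraicClosure E K
  haveI : IsAlgClosed L := IsAlgClosure.isAlgClosed E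
  haveI : PerfectField L := IsAlgClosed.perfectField L
  haveI : Algebra.IsAlgebraic E L := algebraicClosure.isAlgebraic E K
  by_cases htr : Transcendental M t
  · -- the relative perfect closure `L₀` of `E` in `L`: perfect, purely inseparable over `E`
    let L₀ : IntermediateField E L := perfectClosure E L
    haveI : PerfectField L₀ := inferInstanceAs (PerfectField (perfectClosure E L))
    haveI : IsPurelyInseparable E L₀ := perfectClosure.isPurelyInseparable E L
    -- `RatFunc M ≅ E` (t transcendental) makes `L₀` a purely inseparable `RatFunc M`-algebra
    let e : RatFunc M ≃ₐ[M] E := RatFunc.algEquivOfTranscendental t htr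
    letI : Algebra (RatFunc M) E := (e : RatFunc M →+* E).toAlgebra
    letI : Algebra (RatFunc M) L₀ := ((algebraMap E L₀).comp (e : RatFunc M →+* E)).toAlgebra
    haveI : IsScalarTower (RatFunc M) E L₀ := IsScalarTower.of_algebraMap_eq fun _ => rfl
    haveI : IsPurelyInseparable (RatFunc M) E :=
      { isIntegral := Algebra.isIntegral_of_surjective (fun x => ⟨e.symm x, e.apply_symm_apply x⟩)
        inseparable' := fun x _ => ⟨e.symm x, e.apply_symm_apply x⟩ }
    haveI : IsPurelyInseparable (RatFunc M) L₀ := IsPurelyInseparable.trans (RatFunc M) E L₀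
    -- the kernel at `M`: resolution over `L₀`
    have hL₀ : ∀ (Y : Scheme.{0}) (g : Y ⟶ Spec (.of L₀)), IsSeparated g →
        LocallyOfFiniteType g → QuasiCompact g → IsIntegral Y → Scheme.HasResolution Y :=
      fun Y g hs' hl' hq' hY => hRM L₀ Y g hs' hl' hq' hY
    -- `L` is algebraic over `E ⊆ L₀`, hence over the perfect `L₀`: the landed algebraic climb
    haveI : Algebra.IsAlgebraic L₀ L := Algebra.IsAlgebraic.tower_top (K := E) L₀
    exact PrimeFieldToPerfect.stub_climbAlgebraic L₀ hL₀ L X f hs hl hq hX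
  · -- `t` algebraic over `M`: `E / M` is finite, `L / E` algebraic, so `L / M` is algebraic
    have halg : IsAlgebraic M t := Classical.not_not.mp htr
    haveI : FiniteDimensional M E := IntermediateField.adjoin.finiteDimensional halg.isIntegral
    haveI : Algebra.IsAlgebraic M E := Algebra.IsAlgebraic.of_finite M E
    haveI : Algebra.IsAlgebraic M L := Algebra.IsAlgebraic.trans M E L
    exact PrimeFieldToPerfect.stub_climbAlgebraic M hM L X f hs hl hq hX

/-! ## §4 The tower of algebraically closed subfields -/

/-- **The tower.** Let `K` be algebraically closed of characteristic `p`. Assume (i) the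
hypothesis of the crux `PrimeModelTransfer` at `p` — every integral separated scheme of finite type
over an algebraically closed field of characteristic `p` that is algebraic over `𝔽_p` has a
resolution — and (ii) the transfer kernel for ALGEBRAICALLY CLOSED constant fields of
characteristic `p`: for `M` algebraically closed with resolution of all integral separated
finite-type `M`-schemes, resolution over every perfect field purely inseparable over `RatFunc M`.
Then every finite `S ⊆ K` lies in an algebraically closed subfield `A ⊆ K` over which all integral
separated schemes of finite type are resolvable. Induction on `S`: `A(∅)` is the algebraic closure
of `𝔽_p` in `K` (algebraically closed, and algebraic over `𝔽_p`, so (i) applies —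
`pow_prime_pow_eq_self_of_isAlgebraic`); `A(S ∪ {t})` is the algebraic closure of `A(S)(t)` in `K`
(`hasResolution_algebraicClosure_adjoin_simple`, the kernel being used at the algebraically closed
`A(S)`). [folklore] -/
theorem exists_isAlgClosed_subfield_hasResolution (p : ℕ) [Fact p.Prime]
    (K : Type) [Field K] [CharP K p] [IsAlgClosed K]
    (hA : ∀ (k : Type) [Field k] [CharP k p] [IsAlgClosed k],
      (∀ x : k, ∃ n : ℕ, 0 < n ∧ x ^ p ^ n = x) →
      ∀ (X : Scheme.{0}) (f : X ⟶ Spec (.of k)), IsSeparated f → LocallyOfFiniteType f →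
        QuasiCompact f → IsIntegral X → Scheme.HasResolution X)
    (hker : ∀ (M : Type) [Field M] [CharP M p] [IsAlgClosed M],
      (∀ (X : Scheme.{0}) (f : X ⟶ Spec (.of M)), IsSeparated f → LocallyOfFiniteType f →
        QuasiCompact f → IsIntegral X → Scheme.HasResolution X) →
      ∀ (L : Type) [Field L] [PerfectField L] [Algebra (RatFunc M) L]
        [IsPurelyInseparable (RatFunc M) L]
        (X : Scheme.{0}) (f : X ⟶ Spec (.of L)), IsSeparated f → LocallyOfFiniteType f →
          QuasiCompact f → IsIntegral X → Scheme.HasResolution X)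
    (S : Finset K) :
    ∃ A : Subfield K, (↑S : Set K) ⊆ A ∧ IsAlgClosed A ∧
      ∀ (X : Scheme.{0}) (f : X ⟶ Spec (.of A)), IsSeparated f → LocallyOfFiniteType f →
        QuasiCompact f → IsIntegral X → Scheme.HasResolution X := by
  classical
  induction S using Finset.induction_on with
  | empty =>
    -- `A(∅)` = the algebraic closure of the prime field in `K`
    letI : Algebra (ZMod p) K := ZMod.algebra K p
    let A₀ : IntermediateField (ZMod p) K := algebraicClosure (ZMod p) K
    haveI : IsAlgClosed A₀ := IsAlgClosure.isAlgClosed (ZMod p)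
    haveI : CharP A₀ p := (algebraMap A₀ K).charP (algebraMap A₀ K).injective p
    have halg : ∀ x : A₀, ∃ n : ℕ, 0 < n ∧ x ^ p ^ n = x := fun x =>
      pow_prime_pow_eq_self_of_isAlgebraic p x (Algebra.IsAlgebraic.isAlgebraic x)
    refine ⟨A₀.toSubfield, by simp, inferInstanceAs (IsAlgClosed A₀), ?_⟩
    exact fun X f hs hl hq hX => hA A₀ halg X f hs hl hq hX
  | insert t S _ ih =>
    obtain ⟨A, hSA, hAc, hAres⟩ := ih
    -- the constant field of this climb: `M := A`, algebraically closed
    haveI : IsAlgClosed A := hAc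
    haveI : PerfectField A := IsAlgClosed.perfectField A
    haveI : CharP A p := (algebraMap A K).charP (algebraMap A K).injective p
    let E : IntermediateField A K := IntermediateField.adjoin A ({t} : Set K)
    let L : IntermediateField E K := algebraicClosure E K
    haveI : IsAlgClosed L := IsAlgClosure.isAlgClosed E
    refine ⟨L.toSubfield, ?_, inferInstanceAs (IsAlgClosed L), ?_⟩
    · -- `S ∪ {t} ⊆ L`: `t ∈ E ⊆ L` and `S ⊆ A ⊆ E ⊆ L`
      have hEL : ∀ x : K, x ∈ E → x ∈ L.toSubfield := fun x hx => by
        have := L.algebraMap_mem ⟨x, hx⟩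
        simpa using this
      rw [Finset.coe_insert, Set.insert_subset_iff]
      refine ⟨hEL t (IntermediateField.mem_adjoin_simple_self A t), fun x hx => hEL x ?_⟩
      exact E.algebraMap_mem (⟨x, hSA hx⟩ : A)
    · exact fun X f hs hl hq hX =>
        hasResolution_algebraicClosure_adjoin_simple p A hAres (fun L' _ _ _ _ => hker A hAres L')
          K t X f hs hl hq hX

end Summit.ResolutionOfSingularities.ResolutionOfSingularities.Theorems.PrimeModelTransfer

end
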